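import Literature.AlgebraicGeometry.Resolution.KollarEtaleEquivalentSequencesFamily
import Literature.AlgebraicGeometry.Resolution.MarkedIdealsRestrict
import Literature.AlgebraicGeometry.Resolution.BlowupSNC
import HarnessLib

/-!
# Enlarging the boundary by divisors off the cosupport keeps a smooth blow-up sequence admissible (Kollár 2007, 3.104 Steps 2.1–2.2)

Topic: `Literature/AlgebraicGeometry/Resolution`. On the line discharging the named fact
`Kollar2007Thm3_103` (`KollarBlowupSequenceFunctors.lean`; J. Kollár, *Lectures on Resolution of
Singularities*, 2007) through 3.104. Step 2.1 (p. 172 of the held copy) makes "`cosupp(I_r, m)`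
… disjoint from `Π_*^{-1} E`", and Step 2.2 (p. 173) then works with the boundary `H + E` where
only `H_r +` (the new exceptional divisors) is known to be a simple normal crossing divisor
(`KollarMaxContactPersistence.lean`, `KollarMaxContactStepTwoTriple.lean`: the triple
`(X_r, W(I_r), H_r + F_r)`). To return from the blow-up sequence `𝓑𝓓_{n,m,0}(X_r, W(I_r), H_r + F_r)`
to a smooth blow-up sequence of order `≥` for the triple `(X_r, I_r, E_r)` with its FULL boundary
`E_r = (Π_*^{-1} E) + F_r` one forgets `H_r` (`IsAdmissibleFor.of_boundary_sublist`,
`MarkedIdealsRestrict.lean`) and puts back the transforms of the old members of `E`, which are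
disjoint from the cosupport and hence from every centre. This file PROVES that last step, in
general:

* `HasSNCWith.of_disjoint` — a centre with simple normal crossings with `E'` has simple normal
  crossings with a simple normal crossing list `E` all of whose members outside `E'` miss the
  centre;
* **`CentreSeq.IsAdmissibleFor.of_boundary_superset`**, `IsResolutionOf.of_boundary_superset` — a
  smooth blow-up sequence of order `≥ μ` for `(X, I, μ, E')` (resp. an order reduction) is one for
  `(X, I, μ, E)` for every simple normal crossing list `E ⊇ E'` whose members outside `E'` are
  disjoint from `cosupp(I, μ)`; the hypotheses propagate along the sequence (transformed
  boundaries stay snc, `HasSNCWith.hasSNC_transform`; strict transforms lie over their divisor,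
  `support_strictTransformIdeal_subset` / `support_controlledTransform_subset_preimage`; cosupports
  over the cosupport, `MarkedIdeal.support_transform_subset_preimage`).

## Sources

* J. Kollár, *Lectures on Resolution of Singularities*, Ann. of Math. Stud. 166, PUP 2007:
  3.104 Steps 2.1–2.2 (pp. 172–173), Lemma 3.102 (1) (p. 169) of the held copy. [Kollar2007]
-/

noncomputable section

open CategoryTheory CategoryTheory.Limits AlgebraicGeometry TopologicalSpace IsLocalRing

namespace Literature.AlgebraicGeometry.Resolution

universe u

variable {X : Scheme.{u}}

/-- **Simple normal crossings of a centre with another boundary whose members outside the first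
miss the centre**: if `C` has simple normal crossings with `E'`, the list `E` is a simple normal
crossing divisor, and every member of `E` not in `E'` is disjoint from `V(C)`, then `C` has
simple normal crossings with `E` (at a point of `V(C)` the members of `E` through it are members
of `E'`; elsewhere only the snc condition on `E` is asked). This is the situation after 3.104
Step 2.1: "cosupp(I_r, m) is disjoint from `Π_*^{-1}E`", so the centres of Step 2.2 (inside the
cosupport, with simple normal crossings with `H_r +` the new divisors) also have simple normal
crossings with the full boundary `E_r`. [cite: Kollar2007, 3.104 Steps 2.1–2.2 (pp. 172–173)] -/
theorem HasSNCWith.of_disjoint {E E' : List X.IdealSheafData} {C : X.IdealSheafData}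
    (h' : HasSNCWith E' C) (hE : HasSNC E)
    (hdisj : ∀ D ∈ E, D ∉ E' → (D.support : Set X) ∩ C.support = ∅) : HasSNCWith E C := by
  classical
  intro x
  by_cases hx : x ∈ C.support
  · obtain ⟨hreg, u, hu, ⟨ι, hι, hιD⟩, hC⟩ := h' x
    -- the members of `E` through `x` belong to `E'`
    have hmem : ∀ D : {D // D ∈ E ∧ x ∈ D.support}, D.1 ∈ E' := fun D => by
      by_contra hD
      have h0 := hdisj D.1 D.2.1 hD
      have : x ∈ (D.1.support : Set X) ∩ C.support := ⟨D.2.2, hx⟩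
      rw [h0] at this
      exact this
    refine ⟨hreg, u, hu, ⟨fun D => ι ⟨D.1, hmem D, D.2.2⟩, fun D₁ D₂ heq => ?_,
      fun D => hιD ⟨D.1, hmem D, D.2.2⟩⟩, hC⟩
    have e := congrArg Subtype.val (hι heq)
    exact Subtype.ext e
  · obtain ⟨hreg, u, hu, hEx, -⟩ := hE x
    exact ⟨hreg, u, hu, hEx, fun h => (hx h).elim⟩

namespace CentreSeq

/-- **Enlarging the boundary by divisors off the cosupport**: a smooth blow-up sequence of order
`≥ μ` for `(X, I, μ, E')` is one for `(X, I, μ, E)` whenever `E ⊇ E'` is a simple normal crossing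
divisor whose members not in `E'` are disjoint from `cosupp(I, μ)` — the passage, in 3.104
Step 2.2, from the boundary `H_r +` (new divisors) used for `𝓑𝓓_{n,m,0}` back to the full boundary
`E_r`, the old members of which were moved off the cosupport by Step 2.1 (Lemma 3.102 (1):
"`cosupp(I_r, m) ∩ Π_*^{-1} E^j = ∅`"). The hypotheses propagate along the sequence: the
transformed larger boundary keeps simple normal crossings (`HasSNCWith.hasSNC_transform`), and
the transforms of the extra members stay off the cosupport because strict transforms lie over
their divisor and cosupports over the cosupport (`MarkedIdeal.support_transform_subset_preimage`).
[cite: Kollar2007, 3.104 Steps 2.1–2.2 (pp. 172–173) with Lemma 3.102 (1) (p. 169)] -/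
theorem IsAdmissibleFor.of_boundary_superset : ∀ {X : Scheme.{u}} [IsLocallyNoetherian X]
    (s : CentreSeq X) {I : X.IdealSheafData} {E E' : List X.IdealSheafData} {μ : ℕ},
      s.IsAdmissibleFor ⟨I, E', μ⟩ → HasSNC E → (∀ D ∈ E', D ∈ E) →
      (∀ D ∈ E, D ∉ E' → (D.support : Set X) ∩ (⟨I, E', μ⟩ : MarkedIdeal X).support = ∅) →
      s.IsAdmissibleFor ⟨I, E, μ⟩
  | _, _, nil _, _, _, _, _, _, _, _, _ => trivial
  | X, _, cons C rest, I, E, E', μ, h, hE, hsub, hdisj => by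
    obtain ⟨hsupp, hsnc, hC, hrest⟩ := h
    have hsncE : HasSNCWith E C :=
      hsnc.of_disjoint hE fun D hD hD' => by
        apply Set.eq_empty_of_subset_empty
        rw [← hdisj D hD hD']
        exact Set.inter_subset_inter_right _ hsupp
    refine ⟨hsupp, hsncE, hC, ?_⟩
    haveI : IsLocallyNoetherian (blowup C) := isLocallyNoetherian_blowup C
    refine IsAdmissibleFor.of_boundary_superset rest hrest (hsncE.hasSNC_transform (blowup.isBlowup C))
      ?_ ?_
    · -- the transformed larger boundary contains the transformed smaller one
      intro D' hD'
      rcases List.mem_append.mp hD' with hD' | hD'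
      · obtain ⟨D, hD, rfl⟩ := List.mem_map.mp hD'
        exact List.mem_append_left _ (List.mem_map.mpr ⟨D, hsub D hD, rfl⟩)
      · exact List.mem_append_right _ hD'
    · -- the transforms of the extra members stay off the cosupport
      intro D' hD' hD'not
      rcases List.mem_append.mp hD' with hD'm | hD'e
      · obtain ⟨D, hD, rfl⟩ := List.mem_map.mp hD'm
        have hDnot : D ∉ E' := fun hDE' =>
          hD'not (List.mem_append_left _ (List.mem_map.mpr ⟨D, hDE', rfl⟩))
        apply Set.eq_empty_of_subset_empty
        rintro x' ⟨hx'D, hx'M⟩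
        have h1 : blowup.π C x' ∈ (D.support : Set X) := by
          have hsub' := support_strictTransformIdeal_subset (π := blowup.π C) (C := C) D
          have h2 := support_controlledTransform_subset_preimage (π := blowup.π C) (C := C) D 1
            (hsub' hx'D)
          exact h2
        have h2 : blowup.π C x' ∈ ((⟨I, E', μ⟩ : MarkedIdeal X).support) :=
          MarkedIdeal.support_transform_subset_preimage (blowup.isBlowup C) ⟨I, E', μ⟩ hsupp hx'M
        have h3 : blowup.π C x' ∈ (D.support : Set X) ∩ (⟨I, E', μ⟩ : MarkedIdeal X).support :=
          ⟨h1, h2⟩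
        rw [hdisj D hD hDnot] at h3
        exact h3
      · exact absurd (List.mem_append_right _ hD'e) hD'not

/-- **And for order reductions**: the final cosupport does not see the boundary
(`transformMarked_support_eq`). [cite: Kollar2007, 3.104 Step 2.2 (p. 173)] -/
theorem IsResolutionOf.of_boundary_superset {X : Scheme.{u}} [IsLocallyNoetherian X] (s : CentreSeq X)
    {I : X.IdealSheafData} {E E' : List X.IdealSheafData} {μ : ℕ} (h : s.IsResolutionOf ⟨I, E', μ⟩)
    (hE : HasSNC E) (hsub : ∀ D ∈ E', D ∈ E)
    (hdisj : ∀ D ∈ E, D ∉ E' → (D.support : Set X) ∩ (⟨I, E', μ⟩ : MarkedIdeal X).support = ∅) :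
    s.IsResolutionOf ⟨I, E, μ⟩ :=
  ⟨IsAdmissibleFor.of_boundary_superset s h.1 hE hsub hdisj,
    (transformMarked_support_eq s (M := ⟨I, E, μ⟩) (N := ⟨I, E', μ⟩) rfl rfl).trans h.2⟩

end CentreSeq

end Literature.AlgebraicGeometry.Resolution

end
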